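import Summits.QuantumFields.YangMills.Theses.FemtoCutoffLadder
import Summits.QuantumFields.YangMills.Theorems.LuscherReductionTwistedTraceScalingTowerOfUniform

/-!
# Route `FemtoCutoffLadder` (QuantumFields / YangMills; rung R2b1 leaf `FemtoTransferGap.FemtoGapOfRecord`) —
# matched couplings exist DEEP IN THE FEMTO WINDOW (support lemma for the Assembly item stmt-QuantumFields-23510)

Lead seat `ym-line-fcl-p1` (2026-08-27).  The route's support item `MatchedCouplingExists` (stmt-QuantumFields-23509) asks, for EVERY
depth `lam > 0`, every window point `(β, L)` and every lattice size `L' ≥ 1`, for a partner coupling `β' ≥ 1` on `L'` with the same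
Lüscher parameter `Λ(β', L') = Λ(β, L)` (hence in the same window).  As typed — with no depth threshold — that statement is FALSE
(see `FemtoCutoffLadderMatchedCouplingExistsRefutation.lean`: on the one-site lattice `L' = 1` the two-loop label is `≥ 0.4` for every
`β' ≥ 1`, so `Λ(β', 1) ≤ 1.35`, while `(β, L) = (1, 2)` is a window point with `Λ ≈ 1.43`).  What the dyadic telescoping of the route's
Assembly actually consumes is the DEEP-WINDOW version proved here: for `0 < lam ≤ 1/2` the label `1/ḡ²(β, L)` of a window point is `≥ 1`
(`TwoLattice.Tower.one_le_invRunningCoupling_of_window`), every label value `≥ 1` is attained on every lattice at some `β' ≥ 1`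
(intermediate value theorem, `TwoLattice.Tower.exists_matched`), and equal labels give equal `Λ` and the same window
(`TwoLattice.Tower.window_of_matched`, `luscherLambda_eq_of_matched`) — all tree lemmas of the `LuscherReduction` fleet, reused by name.

* `exists_matched_of_window` — the partner at one `(β, L, L')`, depth `lam ≤ 1/2`;
* `matchedCouplingExists_small` — the repaired support: `∃ lam0 > 0, ∀ 0 < lam ≤ lam0, …` (with `lam0 = 1/2`).

HONEST FRAMING: elementary real analysis on the route's labels (femto rung R2b1 bookkeeping); nothing here is a transfer-spectrum
estimate, infinite volume, a mass gap or the Clay problem.  No definitions, no named facts, no `sorry`.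
-/

set_option autoImplicit false

noncomputable section

namespace Summit.QuantumFields.YangMills.Theorems.FemtoCutoffLadder

open Summit.QuantumFields.YangMills.Theorems.FemtoTransferGap

/-- **Matched partner in a deep window.**  If `(β, L)` lies in the femto window of depth `0 < lam ≤ 1/2`, then on every lattice
`L' ≥ 1` there is `β'` with `(β', L')` in the same window and `Λ(β', L') = Λ(β, L)` (IVT on the two-loop label, which is `≥ 1` in
such a window and attains every value `≥ 1` on `[1, ∞)`). [cite: LuscherMunster1984, §2] -/
theorem exists_matched_of_window {lam β : ℝ} {L : ℕ} [NeZero L] (L' : ℕ) [NeZero L'] (hlam : 0 < lam)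
    (hhalf : lam ≤ 1 / 2) (hW : InFemtoWindow lam β L) :
    ∃ β' : ℝ, InFemtoWindow lam β' L' ∧ luscherLambda β' L' = luscherLambda β L := by
  obtain ⟨β', hβ'1, hmatch⟩ :=
    TwoLattice.Tower.exists_matched L' (TwoLattice.Tower.one_le_invRunningCoupling_of_window hlam hhalf hW)
  exact ⟨β', TwoLattice.Tower.window_of_matched hW hβ'1 hmatch, TwoLattice.Tower.luscherLambda_eq_of_matched hmatch⟩

/-- **The repaired support `MatchedCouplingExists` (deep-window form)**: there is `lam0 > 0` (here `1/2`) such that for every depth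
`0 < lam ≤ lam0`, every window point `(β, L)` and every `L' ≥ 1` there is a matched partner `β'` with `(β', L')` in the same window and
`Λ(β', L') = Λ(β, L)`.  This is exactly what the route's dyadic telescoping consumes. [cite: LuscherMunster1984, §2] -/
theorem matchedCouplingExists_small :
    ∃ lam0 : ℝ, 0 < lam0 ∧ ∀ lam : ℝ, 0 < lam → lam ≤ lam0 →
      ∀ (L : ℕ) [NeZero L] (L' : ℕ) [NeZero L'] (β : ℝ), InFemtoWindow lam β L →
        ∃ β' : ℝ, InFemtoWindow lam β' L' ∧ luscherLambda β' L' = luscherLambda β L :=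
  ⟨1 / 2, by norm_num, fun _lam hlam hhalf _L _ L' _ _β hW => exists_matched_of_window L' hlam hhalf hW⟩

end Summit.QuantumFields.YangMills.Theorems.FemtoCutoffLadder

end
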